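import Literature.MathematicalPhysics.QuantumFieldTheory.LatticeGaugeDobrushin
import HarnessLib

/-!
# Venture YMGap, track ROBUST-BALL — the perturbed lattice Yang–Mills specification on `ℤ^d`

HONEST FRAMING. WHAT THIS IS: a venture file (cell `pub-ymgap`, track Y2 ROBUST-BALL, seat rb-p1) that
TYPES the DLR object of a PERTURBED lattice gauge action `S = β S_W + W` on `ℤ^d` — the Wilson action of a
continuous representation `ρ` plus a Georgii interaction potential `W = (W_X)_{X ⋐ links}` on the links —
and proves that its finite-volume kernels form a specification in Georgii's sense for EVERY bounded
measurable adapted `W` with locally finite support family (the tree's `Potential.IsAdapted`,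
`Potential.IsSupportedBy`). At `W = 0` it is the tree's `ymSpecification ρ β` on the nose
(`perturbedYM_zero`). WHAT THIS IS NOT: no mass-gap statement (that is the door file), no choice of norm
or ball (the object `ClusterDomain β⋆ ε` is typed by seat rb-theory; the door theorems downstream are
stated in the loads of `W` so that any typed norm dominating them instantiates), no continuum statement,
no claim about the Yang–Mills Millennium problem. Strong-coupling LATTICE bookkeeping only.

## Contents

* `perturbedEnergy ρ β W supp Λ` — the finite-volume log-Boltzmann weight
  `U ↦ -β S_Λ(U) - H^W_Λ(U)`, `S_Λ` = the tree's boundary Wilson action `wilsonBoundaryAction ρ Λ`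
  (plaquettes touching `Λ`), `H^W_Λ = hamiltonianIn W supp Λ = ∑_{X ∈ supp Λ, X ∩ Λ ≠ ∅} W_X` (the tree's
  finite-volume Hamiltonian of a potential, Georgii (2.11)).
* `perturbedYM ρ β W supp : Specification (ZdEdge d) G` — product Haar measure on the links of `Λ`, glued
  with the boundary condition off `Λ`, tilted by `perturbedEnergy` (Mathlib `Measure.tilted`); the junk
  value of `Measure.tilted` is not hit for bounded measurable `W` (`isProbabilityMeasure_perturbedYM`).
* `perturbedYM_zero : perturbedYM ρ β 0 supp = ymSpecification ρ β` (referee test T1.3).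
* `isSpecification_perturbedYM` — probability / `𝓕_{Λᶜ}`-measurability / properness / consistency,
  for compact Hausdorff second-countable `G`, continuous `ρ`, every real `β`, and every adapted, bounded,
  locally finitely supported `W` — the instance `ν = Haar`, `φ_Λ = perturbedEnergy` of the tree's generic
  theorem `isSpecification_tilted_map_glueWith_pi` (Friedli–Velenik 2017 §6.10.1, Lemma 6.15); the
  relative-energy locality is `dependsOn_wilsonBoundaryAction_sub` + `dependsOn_hamiltonianIn_sub`.
* `perturbedGibbsMeasures` — the DLR states of the member, `= ymGibbsMeasures ρ β` at `W = 0`.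

## References

* H.-O. Georgii, *Gibbs Measures and Phase Transitions* (2011), Def. 1.23, Def. 2.9, (2.11).
* S. Friedli, Y. Velenik, *Statistical Mechanics of Lattice Systems* (2017), §6.3.2 Lemma 6.15,
  §6.10.1 (Gibbsian specifications with a reference measure).
* E. Seiler, LNP 159 (1982), Ch. 2 (the Wilson specification; general lattice actions).
-/

noncomputable section

open MeasureTheory Filter Function
open Literature.Probability.LatticeModels
open Literature.MathematicalPhysics.QuantumLattice
open Literature.MathematicalPhysics.QuantumFieldTheory hiding ZdEdge

namespace Summit.Ventures.YMGap.RobustBall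

variable {d N : ℕ} {G : Type*} [Group G]

/-! ### The perturbed finite-volume energy -/

section Energy

variable (ρ : G →* Matrix (Fin N) (Fin N) ℂ)

/-- **The perturbed finite-volume log-weight** of the link set `Λ`:
`perturbedEnergy ρ β W supp Λ U = -β S_Λ(U) - H^W_Λ(U)`, where `S_Λ` is the boundary Wilson action of
`ρ` (all plaquettes with a link in `Λ`) and `H^W_Λ = ∑_{X ∈ supp Λ, X ∩ Λ ≠ ∅} W_X` is the finite-volume
Hamiltonian of the link potential `W` (tree `hamiltonianIn`). The Boltzmann weight of the member
`S = β S_W + W` of the robust ball in the volume `Λ` is `exp (perturbedEnergy …)`. -/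
def perturbedEnergy (β : ℝ) (W : Potential (ZdEdge d) G)
    (supp : Finset (ZdEdge d) → Finset (Finset (ZdEdge d))) (Λ : Finset (ZdEdge d))
    (U : LGConfig d G) : ℝ :=
  -β * wilsonBoundaryAction ρ Λ U - hamiltonianIn W supp Λ U

/-- At `W = 0` the perturbed energy is the Wilson log-weight `-β S_Λ`. -/
@[simp] theorem perturbedEnergy_zero (β : ℝ) (supp : Finset (ZdEdge d) → Finset (Finset (ZdEdge d)))
    (Λ : Finset (ZdEdge d)) (U : LGConfig d G) :
    perturbedEnergy ρ β 0 supp Λ U = -β * wilsonBoundaryAction ρ Λ U := by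
  simp [perturbedEnergy, hamiltonianIn]

variable [MeasurableSpace G]

/-- **Relative-energy locality**: for `Λ ⊆ Λ'` the difference of the perturbed energies of `Λ'` and
`Λ` does not depend on the links in `Λ` (plaquettes and interaction sets not meeting `Λ` only) — the
hypothesis `hloc` of the tree's `isSpecification_tilted_map_glueWith_pi`
(Friedli–Velenik 2017, eq. (6.10)). -/
theorem dependsOn_perturbedEnergy_sub (β : ℝ) {W : Potential (ZdEdge d) G} (hW : W.IsAdapted)
    {supp : Finset (ZdEdge d) → Finset (Finset (ZdEdge d))} (hsupp : W.IsSupportedBy supp)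
    {Λ Λ' : Finset (ZdEdge d)} (h : Λ ⊆ Λ') :
    DependsOn (fun U : LGConfig d G =>
      perturbedEnergy ρ β W supp Λ' U - perturbedEnergy ρ β W supp Λ U) ((↑Λ : Set (ZdEdge d))ᶜ) := by
  intro U U' hUU'
  have h1 := dependsOn_wilsonBoundaryAction_sub (G := G) ρ h hUU'
  have h2 := dependsOn_hamiltonianIn_sub hW hsupp h hUU'
  simp only at h1 h2 ⊢
  simp only [perturbedEnergy]
  linear_combination (-β) * h1 - h2

/-- The perturbed energy is measurable when `ρ` is continuous (Borel structure on `G`) and the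
interaction terms are measurable. -/
theorem measurable_perturbedEnergy [TopologicalSpace G] [IsTopologicalGroup G] [BorelSpace G]
    [SecondCountableTopology G] (hρ : Continuous ρ) (β : ℝ) {W : Potential (ZdEdge d) G}
    (hWm : ∀ X, Measurable (W X)) (supp : Finset (ZdEdge d) → Finset (Finset (ZdEdge d)))
    (Λ : Finset (ZdEdge d)) : Measurable (perturbedEnergy ρ β W supp Λ) :=
  ((continuous_const.mul (continuous_wilsonBoundaryAction ρ hρ Λ)).measurable).sub
    (measurable_hamiltonianIn hWm supp Λ)

omit [MeasurableSpace G] in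
/-- The perturbed energy is bounded on the (compact) configuration space when `ρ` is continuous and
the interaction terms are bounded: `|-β S_Λ - H^W_Λ| ≤ sup|β S_Λ| + ∑_{X ∈ supp Λ, X ∩ Λ ≠ ∅} C_X`. -/
theorem exists_abs_perturbedEnergy_le [TopologicalSpace G] [IsTopologicalGroup G] [CompactSpace G]
    (hρ : Continuous ρ) (β : ℝ) {W : Potential (ZdEdge d) G} (hWb : ∀ X, ∃ C, ∀ U, |W X U| ≤ C)
    (supp : Finset (ZdEdge d) → Finset (Finset (ZdEdge d))) (Λ : Finset (ZdEdge d)) :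
    ∃ C, ∀ U, |perturbedEnergy ρ β W supp Λ U| ≤ C := by
  choose C hC using hWb
  obtain ⟨C₀, hC₀⟩ := exists_bound_of_continuous
    (continuous_const.mul (continuous_wilsonBoundaryAction ρ hρ Λ) : Continuous fun U : LGConfig d G =>
      -β * wilsonBoundaryAction ρ Λ U)
  refine ⟨C₀ + ∑ X ∈ supp Λ with (X ∩ Λ).Nonempty, C X, fun U => ?_⟩
  calc |perturbedEnergy ρ β W supp Λ U|
      ≤ |-β * wilsonBoundaryAction ρ Λ U| + |hamiltonianIn W supp Λ U| := abs_sub _ _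
    _ ≤ C₀ + ∑ X ∈ supp Λ with (X ∩ Λ).Nonempty, C X :=
        add_le_add (hC₀ U) (abs_hamiltonianIn_le (fun X U => hC X U) supp Λ U)

omit [MeasurableSpace G] in
/-- The perturbed energy is continuous when `ρ` and the interaction terms entering the volume are
continuous (used for the Feller property of the kernels; not needed for `IsSpecification`). -/
theorem continuous_perturbedEnergy [TopologicalSpace G] [IsTopologicalGroup G] (hρ : Continuous ρ)
    (β : ℝ) {W : Potential (ZdEdge d) G} (hWc : ∀ X, Continuous (W X))
    (supp : Finset (ZdEdge d) → Finset (Finset (ZdEdge d))) (Λ : Finset (ZdEdge d)) :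
    Continuous (perturbedEnergy ρ β W supp Λ) := by
  unfold perturbedEnergy hamiltonianIn
  exact (continuous_const.mul (continuous_wilsonBoundaryAction ρ hρ Λ)).sub
    (continuous_finsetSum _ fun X _ => hWc X)

end Energy

/-! ### The perturbed specification -/

section Spec

variable (ρ : G →* Matrix (Fin N) (Fin N) ℂ) [TopologicalSpace G] [IsTopologicalGroup G]
  [CompactSpace G] [MeasurableSpace G] [BorelSpace G]

/-- **The perturbed lattice Yang–Mills specification on `ℤ^d`** of the action `β S_W + W`:
`γ^W_Λ(dU | η) = Z_Λ(η)⁻¹ exp(-β S_Λ(U) - H^W_Λ(U)) ∏_{e ∈ Λ} dHaar(U_e) ⊗ δ_{η off Λ}` — product Haar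
measure on the links of `Λ`, glued with the boundary condition (tree `glueWith`), tilted by the perturbed
energy (Mathlib `Measure.tilted`; junk value `0` iff the normaliser is `0` or `∞`, which does not happen
for continuous `ρ` and bounded measurable `W`, `isProbabilityMeasure_perturbedYM`). The same shape as the
tree's `ymSpecification ρ β` (recovered at `W = 0`, `perturbedYM_zero`) and `gibbsSpecOfPotential`
(Georgii 2011, Def. 2.9; Seiler LNP 159 Ch. 2). -/
def perturbedYM (β : ℝ) (W : Potential (ZdEdge d) G)
    (supp : Finset (ZdEdge d) → Finset (Finset (ZdEdge d))) : Specification (ZdEdge d) G :=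
  fun Λ η => ((Measure.pi fun _ : ↥Λ => haarProbability G).map
    (glueWith Λ · η)).tilted (perturbedEnergy ρ β W supp Λ)

/-- **Consistency with the tree at `W = 0`** (referee test T1.3): the perturbed specification of the
zero potential is the Wilson specification `ymSpecification ρ β`, definitionally up to
`hamiltonianIn 0 = 0`. -/
theorem perturbedYM_zero (β : ℝ) (supp : Finset (ZdEdge d) → Finset (Finset (ZdEdge d))) :
    perturbedYM ρ β 0 supp = ymSpecification (d := d) ρ β := by
  funext Λ η
  simp only [perturbedYM, ymSpecification]
  congr 1
  funext U
  exact perturbedEnergy_zero ρ β supp Λ U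

/-- The set `𝒢(β S_W + W)` of DLR states of the perturbed action: Gibbs measures of `perturbedYM`
(Georgii 2011, Def. 1.23). -/
def perturbedGibbsMeasures (β : ℝ) (W : Potential (ZdEdge d) G)
    (supp : Finset (ZdEdge d) → Finset (Finset (ZdEdge d))) : Set (Measure (LGConfig d G)) :=
  gibbsMeasures (perturbedYM ρ β W supp)

/-- Membership in `perturbedGibbsMeasures` is the DLR condition. -/
@[simp] theorem mem_perturbedGibbsMeasures_iff (β : ℝ) (W : Potential (ZdEdge d) G)
    (supp : Finset (ZdEdge d) → Finset (Finset (ZdEdge d))) (μ : Measure (LGConfig d G)) :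
    μ ∈ perturbedGibbsMeasures ρ β W supp ↔ IsGibbsMeasure (perturbedYM ρ β W supp) μ := Iff.rfl

/-- At `W = 0` the DLR states of the member are the lattice Yang–Mills DLR states of the tree. -/
theorem perturbedGibbsMeasures_zero (β : ℝ) (supp : Finset (ZdEdge d) → Finset (Finset (ZdEdge d))) :
    perturbedGibbsMeasures ρ β 0 supp = ymGibbsMeasures (d := d) ρ β := by
  rw [perturbedGibbsMeasures, perturbedYM_zero]
  rfl

variable [SecondCountableTopology G]

/-- **The perturbed kernels are probability measures** for continuous `ρ` and bounded measurable
interaction terms: the reference measure is a nonzero probability measure and the tilting density is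
bounded, so the `Measure.tilted` junk value is not hit (referee test T1.1). -/
theorem isProbabilityMeasure_perturbedYM (hρ : Continuous ρ) (β : ℝ) {W : Potential (ZdEdge d) G}
    (hWm : ∀ X, Measurable (W X)) (hWb : ∀ X, ∃ C, ∀ U, |W X U| ≤ C)
    (supp : Finset (ZdEdge d) → Finset (Finset (ZdEdge d))) (Λ : Finset (ZdEdge d))
    (η : LGConfig d G) : IsProbabilityMeasure (perturbedYM ρ β W supp Λ η) :=
  isProbabilityMeasure_tilted_map_glueWith_pi (V := ZdEdge d) (haarProbability G)
    Λ η (measurable_perturbedEnergy ρ hρ β hWm supp Λ) (exists_abs_perturbedEnergy_le ρ hρ β hWb supp Λ)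

/-- **The perturbed lattice Yang–Mills kernels form a specification** (Georgii 2011, Def. 1.23 with
Def. 2.9; Friedli–Velenik 2017, §6.10.1 with Lemma 6.15): for a continuous matrix representation `ρ`
of a compact Hausdorff second-countable group `G`, every real `β`, and every link potential `W` that is
adapted (`W_X` depends only on the links of `X` and is measurable), has bounded terms, and is locally
finitely supported (`Potential.IsSupportedBy W supp`), `perturbedYM ρ β W supp` satisfies
`IsSpecification`: probability, `𝓕_{Λᶜ}`-measurability in the boundary condition, properness,
consistency. Instance `ν = Haar`, `φ_Λ = perturbedEnergy` of the tree's
`isSpecification_tilted_map_glueWith_pi`; the locality input is `dependsOn_perturbedEnergy_sub`. -/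
theorem isSpecification_perturbedYM [T2Space G] (hρ : Continuous ρ) (β : ℝ)
    {W : Potential (ZdEdge d) G} (hW : W.IsAdapted) (hWb : ∀ X, ∃ C, ∀ U, |W X U| ≤ C)
    {supp : Finset (ZdEdge d) → Finset (Finset (ZdEdge d))} (hsupp : W.IsSupportedBy supp) :
    IsSpecification (perturbedYM (d := d) ρ β W supp) :=
  isSpecification_tilted_map_glueWith_pi (V := ZdEdge d) (haarProbability G)
    (φ := fun Λ => perturbedEnergy ρ β W supp Λ)
    (fun Λ => measurable_perturbedEnergy ρ hρ β (fun X => (hW X).2) supp Λ)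
    (fun Λ => exists_abs_perturbedEnergy_le ρ hρ β hWb supp Λ)
    (fun _ _ h => dependsOn_perturbedEnergy_sub ρ β hW hsupp h)

end Spec

end Summit.Ventures.YMGap.RobustBall
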